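import Literature.Computability.Complexity.FKPointLocationProtocolRun
import Literature.Computability.Complexity.FournierKoiranTransferAssembly
import Literature.Computability.Complexity.CodeFPStringKit
import HarnessLib

/-!
# Fournier–Koiran 2000, Theorem 2: point location by a polynomial `NP`/sign protocol (proof)

Topic `Literature/Computability/Complexity`, grouping namespace `FKPointLocation`. PROOF of the named
fact `fournierKoiran2000_pointLocation_protocol` (`FournierKoiranTransferAssembly.lean`): Theorem 2
of Fournier–Koiran, *Lower bounds are not easier over the reals: inside PH* (ICALP 2000 = LIP
RR-1999-21, p. 4, §§2.1–2.4) in the protocol rendering — for every polynomial bit-size bound `T` there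
is a polynomial one-bit protocol (polynomial-time selector and probes, `NP` statements) with a
polynomial-time read-out which, against the sign oracle of any `x ∈ ℝⁿ`, produces a rational point
`N/d` at which every sign query of length `≤ T(n)` has the same answer as at `x`. Hence (assembly of
that file) **Theorem 3**: `NDP⁰_ℝovs ⊆ P⁰_ℝovs(NP)`, `fournierKoiran2000_NDPAdd_subset_PAddRelClass_NP_holds`.

The protocol is that of `FKPointLocationProtocolDefs.lean` (`isNPOf`, `qryOf`, `LnpOf`, `readout`;
its simulation of the typed procedure is `FKPointLocationProtocolRun.lean`);
this file supplies

* its polynomial time: `isNPOfFP`, `probeOfFP`, `qryOfFP`, `LverOf_mem_P` / `LnpOf_mem_NP`,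
  `readoutFP`, `exists_pt` (from `FKPointLocation{State,Forms,Checks,Readout}FP`);
* the sign agreement at the read-out point: `readout_spec` (validity of the final certificate,
  `Cert.sign_lin_xStar_eq`, `ratPt_xsOf`, de-homogenisation `affine_sign_agree_of_homogeneous`,
  `signOracle_eq_of_sign_agree`);
* the polynomials `m`, `K`, `qc` from the output-length bounds of the `FP` functions involved
  (`exists_poly_length_le_of_mem_FP`), and the theorem.

## References

* H. Fournier, P. Koiran, *Lower bounds are not easier over the reals: inside PH*, ICALP 2000,
  LNCS 1853 = LIP RR-1999-21: Thm 2 (p. 4), §§2.1–2.4, Prop. 1, Thm 3 (pp. 10–12). [FournierKoiran2000]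
* F. Meyer auf der Heide, *Fast algorithms for n-dimensional restrictions of hard problems*, J. ACM
  35 (1988). [MeyerAufDerHeide1988]
-/

noncomputable section

namespace Literature.Computability.Complexity

namespace FKPointLocation

open _root_.Computability CodeFP Polynomial FKTransfer Brick

/-! ### Polynomial time of the protocol -/

section FP

variable (T : Polynomial ℕ)

/-- The parameters from `(1ⁿ, prev)`. [folklore] -/
theorem POfFP : CodeFP (pairE unE strE) paramsE (fun p : ℕ × List Bool => POf T p.1) := ((paramsOfFP T).comp (fst _ _) :)

/-- The replayed state from `(1ⁿ, prev)`. [cite: FournierKoiran2000, Thm 3 (p. 11)] -/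
theorem ustateOfFP : CodeFP (pairE unE strE) dataE (fun p : ℕ × List Bool => ustate (POf T p.1) p.2) :=
  (ustateFP.comp ((POfFP T).pair (snd _ _)) :)

/-- The scheduled task from `(1ⁿ, prev)`. [folklore] -/
theorem utaskFP : CodeFP (pairE unE strE) taskE (fun p : ℕ × List Bool => utask (POf T p.1) p.2) :=
  ((rawGetOr taskE).comp ((uagendaFP.comp (POfFP T)).pair ((strNatLength.comp (snd _ _)).pair (const _ UTask.fin)))).congr
    fun _ => rfl

/-- Sign tasks by tag. [folklore] -/
theorem isSign_eq (τ : UTask) :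
    τ.isSign = (decide (τ.tag = 0) || decide (τ.tag = 5) || decide (τ.tag = 6) || decide (τ.tag = 7) || decide (τ.tag = 8)) := by
  cases τ <;> rfl

/-- `isSign` is computed on codes. [folklore] -/
theorem isSignFP : CodeFP taskE bitE UTask.isSign := by
  have htag : ∀ k : ℕ, CodeFP taskE bitE (fun τ => decide (τ.tag = k)) := fun k => (natEq.comp (task_tag.pair (const taskE k)) :)
  exact (((((htag 0).or (htag 5)).or (htag 6)).or (htag 7)).or (htag 8)).congr fun τ => by rw [isSign_eq]

/-- **The selector is polynomial-time.** [cite: FournierKoiran2000, §2 (p. 4)] -/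
theorem isNPOfFP : CodeFP (pairE unE strE) bitE (fun p : ℕ × List Bool => isNPOf T p.1 p.2) :=
  (isSignFP.comp (utaskFP T)).not.congr fun _ => rfl

/-- The integer list of a sign query from `(1ⁿ, φ)`. [folklore] -/
theorem squeryListFP : CodeFP (pairE unE affE) vecE (fun p => squeryList p.1 p.2) :=
  ((rawCons intE).comp ((intAdd.comp ((vgetFP.comp ((snd _ _).fst'.pair (natOfUn.comp (fst _ _)))).pair (snd _ _).snd')).pair
    ((rawTakeUn intE).comp ((fst _ _).pair (snd _ _).fst'))) :).congr fun _ => rfl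

/-- **The probed list is polynomial-time** (as its `listBool` code). [cite: FournierKoiran2000, §2.1 Step k] -/
theorem probeOfFP : CodeFP (pairE unE strE) (listE smE) (fun p : ℕ × List Bool => probeOf T p.1 p.2) := by
  have hform : CodeFP (pairE unE strE) affE (fun p : ℕ × List Bool => uqueryForm (POf T p.1) (ustate (POf T p.1) p.2) (utask (POf T p.1) p.2)) :=
    (uqueryFormFP.comp ((POfFP T).pair ((ustateOfFP T).pair (utaskFP T))) :)
  have hl : CodeFP (pairE unE strE) vecE (fun p : ℕ × List Bool => probeOf T p.1 p.2) := (squeryListFP.comp ((fst _ _).pair hform) :)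
  exact (((listOfRaw smE).comp ((map₀ smOfInt).comp hl)) :).congr fun p => by simp

/-- **The probe is polynomial-time.** [cite: FournierKoiran2000, §2 (p. 4)] -/
theorem qryOfFP (m : Polynomial ℕ) : CodeFP (pairE unE strE) strE (fun p : ℕ × List Bool => qryOf T m p.1 p.2) :=
  (CodeFP.takeD.comp (((polyUn m).comp (fst _ _)).pair (ofStrE (probeOfFP T)))).congr fun _ => rfl

/-- The probe has length exactly `m(n)`. [folklore] -/
theorem length_qryOf (m : Polynomial ℕ) (n : ℕ) (prev : List Bool) : (qryOf T m n prev).length = m.eval n :=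
  List.takeD_length _ _ _

/-- The check of a certificate against `(1ⁿ, prev)` is polynomial-time. [cite: FournierKoiran2000, §2.1–2.2] -/
theorem ucheckOfFP : CodeFP (pairE (pairE unE strE) strE) bitE (fun p : (ℕ × List Bool) × List Bool =>
    ucheck (POf T p.1.1) (2 ^ (T.eval p.1.1 + 1)) (ustate (POf T p.1.1) p.1.2) (utask (POf T p.1.1) p.1.2) p.2) :=
  (ucheckFP.comp ((((POfFP T).comp (fst _ _)).pair ((boundOfFP T).comp (fst _ _).fst')).pair (((ustateOfFP T).comp (fst _ _)).pair
    (((utaskFP T).comp (fst _ _)).pair (snd _ _)))) :)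

/-- **The verifier language is in `P`.** [cite: FournierKoiran2000, §2.1 ("with a boolean NP algorithm")] -/
theorem LverOf_mem_P : LverOf T ∈ Classes.P := by
  obtain ⟨g, hg, hgs⟩ := ucheckOfFP T
  let canon : List Bool → List Bool := fanoutFn (fanoutFn (onesFn ∘ fstF ∘ fstF) (sndF ∘ fstF)) sndF
  have hcanon : canon ∈ FP :=
    fanoutFn_mem_FP (fanoutFn_mem_FP (comp_mem_FP onesFn_mem_FP (comp_mem_FP fstF_mem_FP fstF_mem_FP)) (comp_mem_FP sndF_mem_FP fstF_mem_FP))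
      sndF_mem_FP
  have hval : ∀ z, g (canon z) = bitE (ucheck (POf T (fstF (fstF z)).length) (2 ^ (T.eval (fstF (fstF z)).length + 1))
      (ustate (POf T (fstF (fstF z)).length) (sndF (fstF z))) (utask (POf T (fstF (fstF z)).length) (sndF (fstF z))) (sndF z)) := by
    intro z
    have hc : canon z = boolPair (boolPair (unE (fstF (fstF z)).length) (sndF (fstF z))) (sndF z) := by
      simp [canon, fanoutFn_apply, onesFn, Function.comp]
    rw [hc]
    exact hgs (((fstF (fstF z)).length, sndF (fstF z)), sndF z)
  refine mem_P_of_mem_FP (comp_mem_FP hg hcanon) (LverOf T) fun z => ⟨fun hz => ?_, fun hz => ?_⟩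
  · have hz' : ucheck (POf T (fstF (fstF z)).length) (2 ^ (T.eval (fstF (fstF z)).length + 1))
        (ustate (POf T (fstF (fstF z)).length) (sndF (fstF z))) (utask (POf T (fstF (fstF z)).length) (sndF (fstF z))) (sndF z) = true := hz
    rw [Function.comp_apply, hval, hz']; rfl
  · have hz' : ucheck (POf T (fstF (fstF z)).length) (2 ^ (T.eval (fstF (fstF z)).length + 1))
        (ustate (POf T (fstF (fstF z)).length) (sndF (fstF z))) (utask (POf T (fstF (fstF z)).length) (sndF (fstF z))) (sndF z) = false :=
      Bool.eq_false_iff.2 hz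
    rw [Function.comp_apply, hval, hz']; rfl

/-- **The `NP` statements form an `NP` language.** [cite: FournierKoiran2000, §2.1, Thm 2] -/
theorem LnpOf_mem_NP (qc : Polynomial ℕ) : LnpOf T qc ∈ Nondeterministic.NP :=
  ⟨LverOf T, LverOf_mem_P T, qc, fun _ => Iff.rfl⟩

/-- **The read-out is polynomial-time.** [cite: FournierKoiran2000, p. 11] -/
theorem readoutFP : CodeFP (pairE unE strE) (pairE natE vecE) (fun p : ℕ × List Bool => readout T p.1 p.2) := by
  have hxs : CodeFP (pairE unE strE) (pairE vecE natE) (fun p : ℕ × List Bool =>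
      uxsOf (POf T p.1) (POf T p.1).amax (ustate (POf T p.1) p.2).levels) :=
    (uxsOfFP.comp (((POfFP T).pair (params_amax.comp (POfFP T))).pair (data_levels.comp (ustateOfFP T))) :)
  exact (((intToNat.comp (vgetFP.comp (hxs.fst'.pair (natOfUn.comp (fst _ _))))).pair ((rawTakeUn intE).comp ((fst _ _).pair hxs.fst'))) :).congr
    fun p => by simp only [readout]; rfl

/-- **The read-out string function**: `⟨1ⁿ, answers⟩ ↦ ⟨1ⁿ, ratCode d N⟩`, in `FP`. [cite: FournierKoiran2000, Thm 2] -/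
theorem exists_pt : ∃ pt : List Bool → List Bool, pt ∈ FP ∧ ∀ (n : ℕ) (prev : List Bool),
    pt (boolPair (unaryEncodeNat n) prev) = boolPair (unaryEncodeNat n) (ratCode (readout T n prev).1 (readout T n prev).2) := by
  have hl : CodeFP (pairE unE strE) vecE (fun p : ℕ × List Bool => ((readout T p.1 p.2).1 : ℤ) :: (readout T p.1 p.2).2) :=
    ((rawCons intE).comp ((intOfNat.comp (readoutFP T).fst').pair (readoutFP T).snd') :)
  have hcode : CodeFP (pairE unE strE) (listE smE) (fun p : ℕ × List Bool => ((readout T p.1 p.2).1 : ℤ) :: (readout T p.1 p.2).2) :=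
    (((listOfRaw smE).comp ((map₀ smOfInt).comp hl)) :).congr fun p => by simp
  obtain ⟨f, hf, hfs⟩ := (fst unE strE).pair hcode
  refine ⟨f, hf, fun n prev => ?_⟩
  refine (hfs (n, prev)).trans ?_
  rw [ratCode, listE_eq]; rfl

end FP

/-! ### The sign agreement at the read-out point -/

section Agreement

variable {T : Polynomial ℕ} {m qc : Polynomial ℕ} {n : ℕ} {x : Fin n → ℝ}

/-- Re-indexing a point along an equality of dimensions does not change its sign oracle. [folklore] -/
theorem signOracle_congr_cast {k k' : ℕ} (y : Fin k → ℝ) (y' : Fin k' → ℝ) (h : k = k') (hy : ∀ i, y i = y' (Fin.cast h i)) :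
    signOracle y = signOracle y' := by
  subst h
  have : y = y' := funext fun i => by simpa using hy i
  rw [this]

/-- **The read-out point decides like `x`.** After `t ≥ |agenda|` genuine answers, `readout` yields
`(d, N)` with `d > 0`, `|N| = n`, and `signOracle x w = signOracle (N/d) w` for every query of length
`≤ T(n)`: the final certificate is valid, its rational point `x*` lies in the face of `x̂` for all
linear forms with coefficients `≤ 2^{T(n)+1}` (`Cert.sign_lin_xStar_eq`), `uxsOf` computes it
(`ratPt_xsOf`), and de-homogenising gives the affine statement (`affine_sign_agree_of_homogeneous`,
`signOracle_eq_of_sign_agree`; coefficients of a query of length `≤ T(n)` are `< 2^{T(n)+1}`).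
[cite: FournierKoiran2000, Thm 2 with §2.3–2.4 and Thm 3 (p. 11)] -/
theorem readout_spec
    (hm : ∀ t < (agenda (QOf T n)).length, (listE smE (probeOf T n (tans T n x t))).length ≤ m.eval n)
    (hqc : ∀ k, n ≤ k → (QOf T n).Wf + 2 * (QOf T n).Wa ≤ qc.eval k) {t : ℕ} (ht : (agenda (QOf T n)).length ≤ t) :
    0 < (readout T n (answers (isNPOf T) (qryOf T m) (LnpOf T qc) (signEnv x) n t)).1 ∧
    (readout T n (answers (isNPOf T) (qryOf T m) (LnpOf T qc) (signEnv x) n t)).2.length = n ∧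
    ∀ w : List Bool, w.length ≤ T.eval n →
      signOracle x w = signOracle (ratPoint (readout T n (answers (isNPOf T) (qryOf T m) (LnpOf T qc) (signEnv x) n t)).1
        (readout T n (answers (isNPOf T) (qryOf T m) (LnpOf T qc) (signEnv x) n t)).2) w := by
  -- the final typed state and its valid certificate
  have hstate : ustate (POf T n) (answers (isNPOf T) (qryOf T m) (LnpOf T qc) (signEnv x) n t) =
      (finalData (QOf T n) (finT T n) (hat x)).toU := ustate_answers hm hqc ht
  have hV := finalData_valid (Q := QOf T n) (finT := finT T n) (xh := hat x) hat_ne_zero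
  obtain ⟨hne, hpos⟩ := finalData_levels (Q := QOf T n) (finT := finT T n) (xh := hat x) hat_ne_zero
  -- scales of the recorded levels are within `amax` (size invariant of the replayed state)
  obtain ⟨K, hK⟩ := usz_ustate (POf T n) (answers (isNPOf T) (qryOf T m) (LnpOf T qc) (signEnv x) n t)
  rw [hstate] at hK
  have hU : ∀ r ∈ (finalData (QOf T n) (finT T n) (hat x)).levels, r.sc ≤ (POf T n).amax := fun r hr =>
    (hK.levels r.toU (List.mem_map.2 ⟨r, hr, rfl⟩)).sc
  obtain ⟨hX2, hrat⟩ := ratPt_xsOf (finalData (QOf T n) (finT T n) (hat x)) hpos hU hne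
  obtain ⟨X, hX⟩ : ∃ X, X = xsOf (QOf T n) (POf T n).amax (finalData (QOf T n) (finT T n) (hat x)).levels := ⟨_, rfl⟩
  rw [← hX] at hX2 hrat
  have hxs : uxsOf (POf T n) (POf T n).amax (ustate (POf T n) (answers (isNPOf T) (qryOf T m) (LnpOf T qc) (signEnv x) n t)).levels =
      (List.ofFn X.1, X.2) := by
    rw [hstate, hX]; exact (toU_xsOf _ _).symm
  -- the located point and the sign agreement on linear forms
  have hXsi : ∀ i, (((certOf (QOf T n) (finalData (QOf T n) (finT T n) (hat x))).xStar 0 i : ℚ) : ℝ) = (X.1 i : ℝ) / X.2 := by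
    intro i
    rw [← hrat]
    simp [ratPt]
  have hB1 : 1 ≤ (QOf T n).B := (QOf T n).one_le_B
  obtain ⟨hlast, hsign⟩ := affine_sign_agree_of_homogeneous x
    (fun i => (((certOf (QOf T n) (finalData (QOf T n) (finT T n) (hat x))).xStar 0 i : ℚ) : ℝ)) hB1
    (fun a ha => Cert.sign_lin_xStar_eq hV a ha)
  -- the integer data read out
  have hX2R : (0 : ℝ) < X.2 := by exact_mod_cast hX2
  have hlastZ : 0 < X.1 (Fin.last n) := by
    have h := hlast
    simp only [hXsi] at h
    have : (0 : ℝ) < X.1 (Fin.last n) := by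
      by_contra hle
      push Not at hle
      exact absurd h (not_lt.2 (div_nonpos_of_nonpos_of_nonneg hle hX2R.le))
    exact_mod_cast this
  have hv : vget (List.ofFn X.1) n = X.1 (Fin.last n) := vget_ofFn X.1 (Fin.last n)
  have hread : readout T n (answers (isNPOf T) (qryOf T m) (LnpOf T qc) (signEnv x) n t) = ((X.1 (Fin.last n)).toNat, (List.ofFn X.1).take n) := by
    rw [readout, hxs]
    show ((vget (List.ofFn X.1) n).toNat, (List.ofFn X.1).take n) = _
    rw [hv]
  have hd : (((X.1 (Fin.last n)).toNat : ℕ) : ℝ) = (X.1 (Fin.last n) : ℝ) := by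
    have : ((X.1 (Fin.last n)).toNat : ℤ) = X.1 (Fin.last n) := Int.toNat_of_nonneg hlastZ.le
    exact_mod_cast this
  have hDn : n ≤ (QOf T n).D := Nat.le_succ n
  have hlenN : ((List.ofFn X.1).take n).length = n := by rw [List.length_take, List.length_ofFn, min_eq_left hDn]
  rw [hread]
  refine ⟨by simpa using hlastZ, hlenN, fun w hw => ?_⟩
  -- de-homogenised point
  have hq : ∀ l, (encodingIntBool.listBool).decode w = some l → ∀ z ∈ l, z.natAbs ≤ (QOf T n).B := by
    intro l hl z hz
    have h1 := natAbs_of_decode_listBool_lt w l hl z hz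
    have h2 : 2 ^ (w.length + 1) ≤ (QOf T n).B := by
      show 2 ^ (w.length + 1) ≤ 2 ^ (T.eval n + 1)
      exact Nat.pow_le_pow_right (by norm_num) (by omega)
    omega
  rw [signOracle_eq_of_sign_agree x _ (QOf T n).B hsign w hq]
  refine congrFun (signOracle_congr_cast _ _ hlenN.symm fun i => ?_) w
  rw [ratPoint]
  simp only [List.get_eq_getElem, Fin.val_cast, List.getElem_take, List.getElem_ofFn, hd, hXsi]
  rw [div_div_div_cancel_right₀ hX2R.ne']
  rfl

end Agreement

/-! ### The theorem -/

/-- Length of the schedule against the code of the schedule. [folklore] -/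
theorem length_agenda_le_length_code (T : Polynomial ℕ) (n : ℕ) : (agenda (QOf T n)).length ≤ (rawE taskE (uagenda (POf T n))).length := by
  rw [← map_toU_agenda, ← List.length_map (f := Task.toU)]
  exact length_le_length_rawE _ _

/-- **Fournier–Koiran 2000, Theorem 2 (point location in `FP⁰_ℝovs(NP)`), protocol rendering — PROVED.**
For every polynomial `T` there are polynomials `m`, `K`, a polynomial-time selector and probe code, an
`NP` language of statements and a polynomial-time read-out such that, against the sign oracle of any
`x ∈ ℝⁿ`, the read-out of the `K(n)` answers is `⟨1ⁿ, ratCode d N⟩` for a rational point `N/d` at which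
every sign query of length `≤ T(n)` has the same answer as at `x`. [cite: FournierKoiran2000, Thm 2 (report p. 4) with §§2.1–2.4 and Prop. 1] -/
theorem fournierKoiran2000_pointLocation_protocol_holds : fournierKoiran2000_pointLocation_protocol := by
  intro T
  -- the polynomials: probe budget `m`, number of questions `K`, certificate budget `qc`
  obtain ⟨f, hf, hfs⟩ := ofStrE (probeOfFP T)
  obtain ⟨R, hR⟩ := exists_poly_length_le_of_mem_FP hf
  obtain ⟨g, hg, hgs⟩ := uagendaFP.comp (paramsOfFP T)
  obtain ⟨R', hR'⟩ := exists_poly_length_le_of_mem_FP hg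
  obtain ⟨h, hh, hhs⟩ := paramsOfFP T
  obtain ⟨R'', hR''⟩ := exists_poly_length_le_of_mem_FP hh
  obtain ⟨pt, hpt, hpts⟩ := exists_pt T
  have hKa : ∀ n, (agenda (QOf T n)).length ≤ R'.eval n := fun n => by
    have := hR' (unE n)
    rw [hgs n, length_unE] at this
    exact (length_agenda_le_length_code T n).trans this
  have hqc : ∀ n k, n ≤ k → (QOf T n).Wf + 2 * (QOf T n).Wa ≤ (3 * R'').eval k := fun n k hnk => by
    obtain ⟨-, -, -, -, hWf, hWa, -, -⟩ := params_le_length (POf T n)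
    have h1 : (paramsE (POf T n)).length ≤ R''.eval k := by
      have := hR'' (unE n)
      rw [hhs n, length_unE] at this
      exact this.trans (TM2Iter.eval_mono R'' hnk)
    have hWf' : (QOf T n).Wf = (POf T n).Wf := rfl
    have hWa' : (QOf T n).Wa = (POf T n).Wa := rfl
    rw [hWf', hWa', eval_mul, eval_ofNat]
    linarith
  refine ⟨R.comp (2 * X + 2 + R'), R', isNPOf T, qryOf T (R.comp (2 * X + 2 + R')), LnpOf T (3 * R''), pt,
    isNPOfFP T, qryOfFP T _, fun n prev => length_qryOf T _ n prev, LnpOf_mem_NP T _, hpt, fun n x => ?_⟩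
  have hm : ∀ t < (agenda (QOf T n)).length, (listE smE (probeOf T n (tans T n x t))).length ≤ (R.comp (2 * X + 2 + R')).eval n := by
    intro t ht
    have := hR (pairE unE strE (n, tans T n x t))
    rw [hfs] at this
    have hl : (pairE unE strE (n, tans T n x t)).length = 2 * n + 2 + t := by
      rw [pairE_apply, length_boolPair, length_unE]
      change _ + (tans T n x t).length = _
      rw [length_tans]
    rw [hl] at this
    refine (le_of_eq_of_le rfl this).trans ?_
    rw [eval_comp]
    refine TM2Iter.eval_mono R ?_
    simp only [eval_add, eval_mul, eval_ofNat, eval_X]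
    have := hKa n
    omega
  obtain ⟨hd, -, hagree⟩ := readout_spec (x := x) hm (hqc n) (hKa n)
  exact ⟨_, _, hd, hpts n _, hagree⟩

/-- **Fournier–Koiran 2000, Theorem 3 (with Fact 2): `NDP⁰_ℝovs ⊆ P⁰_ℝovs(NP)` — PROVED** (the named fact
`fournierKoiran2000_NDPAdd_subset_PAddRelClass_NP` of `FournierKoiranTransfer.lean`, from Theorem 2 by
the assembly `fournierKoiran2000_NDPAdd_subset_PAddRelClass_NP_holds_of`).
[cite: FournierKoiran2000, Thm 3 (report p. 10) with Fact 2 and Thm 2] -/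
theorem fournierKoiran2000_NDPAdd_subset_PAddRelClass_NP_holds : fournierKoiran2000_NDPAdd_subset_PAddRelClass_NP :=
  fournierKoiran2000_NDPAdd_subset_PAddRelClass_NP_holds_of fournierKoiran2000_pointLocation_protocol_holds

end FKPointLocation

end Literature.Computability.Complexity

end
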